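import Summits.HodgeConjecture.HodgeConjecture.Theorems.MarkmanPartnerTransportPicardThreeK3SquaresRMTypeOpenSubtypeByName
import Summits.HodgeConjecture.HodgeConjecture.Theorems.MarkmanPartnerTransportPicardThreeK3SquaresZeta9TypePicardTen
import HarnessLib

/-!
# Route MarkmanPartnerTransport · crux `PicardThreeK3Squares` (stmt-HodgeConjecture-19652) —
# HC⁴(S ⊗ S) for the SUB-TYPES of the ζ₉ real-multiplication type (cubic RM by `ℚ(ζ₉ + ζ₉⁻¹)`,
# Picard number 13 included), from the cycle on every member of the maximal family

Cell hodge-nonav, crux #4 (HC⁴(S ⊗ S), ρ(S) ≥ 3; open core: real multiplication), programme «RATIONAL ORBIT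
DENSITY» continued (prover seat hodge-nonav-19652-p1 gen 20; `--supports stmt-HodgeConjecture-19652`,
helper). CONDITIONAL on the named fact `Buskin2019_hodgeIsometry_algebraic` and a DISPLAYED strong open
input (the ∀-MEMBER form of the van Geemen–Schütt ζ₉ open-period-set fact, proposed separately under
`Literature/AlgebraicGeometry/Surfaces/K3RealMultiplicationZeta9OpenFamily`); credits nothing; nothing here
says HC is proved; rung F-H1 not moved.

THE POINT. `exists_zeta9Type_hodgeConjectureFor_square` (gen 12) settles BY NAME the K3 squares of the ζ₉
rational real-multiplication type — the surfaces whose generator is conjugate to the model `θ_ℂ` on ALL of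
`H²`; they all have Picard number `10` (`…Zeta9TypeOfConj`). The ζ₉ Hodge locus (a `2`-dimensional family
of periods) also carries Noether–Lefschetz-SPECIAL K3 surfaces: Picard number `13`, `T(S)_ℚ` an
`F`-subspace of `F`-rank `3` of the model's rank-`4` space (`F = ℚ(ζ₉ + ζ₉⁻¹)`), the generator conjugate
to `θ` on `T(S)` ONLY. By the sub-type descent (T⁗) (`…RMTypeOpenSubtype{,ByName}`: orbit density +
Buskin transport + NS-ABSORPTION) these are reached by the same mechanism PROVIDED the family's cycle is
available at every member over the open period set, not only at the `θ`-generic ones — which is what van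
Geemen–Schütt's construction gives (the cycle `Γ₁ + Γ₋₁` lives on every member of the Dickson
deformation; the existing tree fact `VanGeemenSchuett2025_zeta9_cycleOnOpenPeriodSet` recorded only the
`θ`-generic quantification «because that is the consumer's binder»). This file derives, with the strong
input DISPLAYED (`OpenAll[θ, e₀]`; the by-name corollary consuming the ∀-member fact follows in a companion
once that fact is in the Literature layer):

* `aeval_X_mul_cubic_eq_zero_of_zeta9Model` — the model identity `θ_ℂ·(θ_ℂ³ - 3θ_ℂ + 1) = 0` in the
  `aeval` form consumed by (T⁗); `cubic_separable`, `cubic_eval_zero_ne_zero`.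
* `hodgeConjectureFor_square_of_zeta9Model_of_openAll` — (T⁗) for a ζ₉ datum GIVEN the strong open
  input (reusable ∀-datum form, mod Buskin only).
  WHICH SURFACES (Witt over `ℚ`, not formalised): every marked projective K3 surface with an endomorphism
  `t` (rational, type-preserving, killing `N¹`, `t³ - 3t + 1 = 0` on `T(S)`, generating `End_Hdg T(S)`)
  conjugate to `θ_ℂ` ON `T(S)` by a rational isometry of `Λ_ℚ` — i.e. every K3 surface with real
  multiplication by `F = ℚ(ζ₉ + ζ₉⁻¹)` whose `F`-quadratic space `(T(S)_ℚ, Φ_S)` is represented by the ζ₉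
  model's: all of Picard number `10` (the type itself) or `13` (a CONDITION on the ternary `F`-form —
  Hasse–Minkowski over `F`, local symbols at finitely many primes; the first kernel content on the cell's
  plan-only rung «RungRank13», cubic RM over a compact Shimura curve).

No definition, no sorry, no new named fact. References: van
Geemen–Schütt, Forum Math. Sigma 13 (2025) e2, Thm. 1.1 (9), §2.6, §3.4, §4.5–4.8, §5.6, §6.6;
Artebani–Comparin–Valdés, Comm. Algebra 48 (2020), Ex. 3.5; Buskin, J. reine angew. Math. 755 (2019),
Thm. 1.1; van Geemen, Michigan Math. J. 56 (2008) Lemma 3.2; O'Meara, *Introduction to Quadratic Forms*,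
63:21, 66:3; Huybrechts, *Lectures on K3 Surfaces*, Ch. 6 Prop. 1.5.
-/

set_option linter.dupNamespace false

noncomputable section

namespace Summit.HodgeConjecture.HodgeConjecture.Theorems.MarkmanPartnerTransport.RMTypeOrbit

open CategoryTheory MonoidalCategory Polynomial
open Literature.AlgebraicGeometry Literature.AlgebraicGeometry.Motives Literature.AlgebraicGeometry.HodgeTheory
open Literature.AlgebraicGeometry.Surfaces Literature.LinearAlgebra.QuadraticForm
open Literature.AlgebraicTopology.SingularHomology
open Summit.HodgeConjecture.HodgeConjecture.Theorems.NikulinTwinTransport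
open Summit.HodgeConjecture.HodgeConjecture.Theorems.MarkmanPartnerTransport.IsogenyInvariance
open Summit.HodgeConjecture.HodgeConjecture.Theorems.MarkmanPartnerTransport.RMTypeDescent

/-- `MarkedK3[S, η, p, x]`: VERBATIM the `let MarkedK3 := …` binder of the route declaration
`PicardThreeK3Squares` (as in `…RMTypeDescent`). Local notation only. -/
local notation3 (prettyPrint := false) "MarkedK3[" S ", " η ", " p ", " x "]" =>
  (p ≠ 0 ∧ (IsIntegralClass p ∧
    (∀ q : complexBetti S (2 * 2), IsIntegralClass q → ∃ n : ℤ, q = n • p) ∧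
    (∀ c : complexBetti S (2 * 1), IsIntegralClass c ↔ ∃ v : K3Index → ℤ, η c = fun i => (v i : ℂ)) ∧
    (∀ a b : complexBetti S (2 * 1),
      cupProduct (rfl : 2 * 1 + 2 * 1 = 2 * 2) a b = k3Form (η a) (η b) • p) ∧
    IsOfHodgeType 2 S (2 * 1) 2 0 (LinearEquiv.symm η x) ∧
    (∀ τ : complexBetti S (2 * 1), IsOfHodgeType 2 S (2 * 1) 2 0 τ →
      ∃ t : ℂ, τ = t • LinearEquiv.symm η x)) ∧
    (k3Form x x = 0 ∧ 0 < (k3Form (star x) x).re ∧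
      ∃ u : K3Index → ℤ, k3Form (fun i => (u i : ℂ)) x = 0 ∧ 0 < ∑ i, ∑ j, u i * k3Gram i j * u j))

variable {S : SchemeOver ℂ}

/-- `CycleAll[θ, e, U]`: the STRONG ∃-form open-set input — at EVERY period point of `D_{θ,e}` in `U`
(`θ`-generic OR NOT) there is a marked projective K3 surface carrying an algebraic class inducing
`η'⁻¹ θ_ℂ η'`. (`CycleEx[θ, e, U]` of `…RMTypeOpenExists` is the same clause restricted to `θ`-generic
periods.) Local notation only. -/
local notation3 (prettyPrint := false) "CycleAll[" θ ", " e ", " U "]" =>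
  (∀ y : K3Index → ℂ, y ∈ U → thetaC θ y = (e : ℂ) • y → k3Form y y = 0 → 0 < (k3Form (star y) y).re →
    ∃ (S' : SchemeOver ℂ) (hS' : IsK3Surface S') (η' : complexBetti S' (2 * 1) ≃ₗ[ℂ] (K3Index → ℂ))
      (p' : complexBetti S' (2 * 2)), MarkedK3[S', η', p', y] ∧
      ∃ γ' ∈ algebraicClasses (S' ⊗ S') 2, ∀ z : complexBetti S' (2 * 1),
        (η'.symm.toLinearMap ∘ₗ (thetaC θ ∘ₗ η'.toLinearMap)) z =
          complexGysin complexOrientationFamily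
            (IsSmoothProjective.tensor_holds hS'.isSmoothProjective hS'.isSmoothProjective)
            hS'.isSmoothProjective (SemiCartesianMonoidalCategory.fst S' S')
            (rfl : 2 * 1 + 2 * 2 + 2 * 2 = 2 * 1 + 2 * (2 + 2))
            (cupProduct (rfl : 2 * 1 + 2 * 2 = 2 * 1 + 2 * 2)
              (complexBetti.map (SemiCartesianMonoidalCategory.snd S' S') (2 * 1) z) γ'))

/-- `OpenAll[θ, e]`: there is an open `U ⊂ Λ_ℂ` containing a `θ`-GENERIC period point of `D_{θ,e}` on
which `CycleAll[θ, e, U]` holds. Local notation only. -/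
local notation3 (prettyPrint := false) "OpenAll[" θ ", " e "]" =>
  (∃ U : Set (K3Index → ℂ), IsOpen U ∧
    (∃ y₁ ∈ U, thetaC θ y₁ = (e : ℂ) • y₁ ∧ k3Form y₁ y₁ = 0 ∧ 0 < (k3Form (star y₁) y₁).re ∧
      ∀ v : K3Index → ℚ, k3Form (fun i => (v i : ℂ)) y₁ = 0 → Matrix.mulVec θ v = 0) ∧
    CycleAll[θ, e, U])

/-- `Zeta9Model[g, y₀, θ]`: VERBATIM the datum conjuncts of the named fact
`VanGeemenSchuett2025_zeta9_cycleOnOpenPeriodSet` (as in `…Zeta9Type`). Local notation only. -/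
local notation3 (prettyPrint := false) "Zeta9Model[" g ", " y₀ ", " θ "]" =>
  ((∀ a b : K3Index → ℂ, k3Form (g a) (g b) = k3Form a b) ∧
    (∀ v : K3Index → ℤ, ∃ w : K3Index → ℤ,
      g (fun i => ((v i : ℤ) : ℂ)) = fun i => ((w i : ℤ) : ℂ)) ∧
    g ^ 9 = 1 ∧
    Module.finrank ℂ (LinearMap.ker (g ^ 3 - 1)) = 10 ∧
    k3Form y₀ y₀ = 0 ∧ 0 < (k3Form (star y₀) y₀).re ∧
    g y₀ = Complex.exp (2 * Real.pi * Complex.I / 9) • y₀ ∧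
    (∀ y : K3Index → ℂ, thetaC θ y =
      (1 / 3 : ℂ) • ((2 : ℂ) • g y + (2 : ℂ) • (g ^ 8) y - (g ^ 2) y - (g ^ 4) y - (g ^ 5) y
        - (g ^ 7) y)))

/-- The cubic `X³ - 3X + 1 ∈ ℚ[X]` (minimal polynomial of `2cos(2π/9)`). Local notation only. -/
local notation3 (prettyPrint := false) "P₉" => (X ^ 3 - C (3 : ℚ) * X + 1 : ℚ[X])

/-- `SubSquareHC[θ]`: **HC⁴(S ⊗ S) for every marked projective K3 surface whose endomorphism `t`
(rational, type-preserving, killing `N¹`, annihilated on `T(S)` by `X³ - 3X + 1`, generating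
`End_Hdg T(S)`) is conjugate to `θ_ℂ` ON THE TRANSCENDENTAL CLASSES by a rational isometry `σ` of
`Λ_ℚ`** — the sub-types of `θ` (Noether–Lefschetz-special surfaces included). Local notation only. -/
local notation3 (prettyPrint := false) "SubSquareHC[" θ "]" =>
  (∀ (S : SchemeOver ℂ) (hS : IsK3Surface S)
    (η : complexBetti S (2 * 1) ≃ₗ[ℂ] (K3Index → ℂ)) (p : complexBetti S (2 * 2)) (x : K3Index → ℂ)
    (_hM : MarkedK3[S, η, p, x])
    (t : complexBetti S (2 * 1) →ₗ[ℂ] complexBetti S (2 * 1))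
    (_ht_rat : ∀ y, IsRationalClass y → IsRationalClass (t y))
    (_ht_typ : ∀ (i j : ℕ) (y : complexBetti S (2 * 1)),
      IsOfHodgeType 2 S (2 * 1) i j y → IsOfHodgeType 2 S (2 * 1) i j (t y))
    (_ht_N : ∀ d ∈ algebraicClasses S 1, t d = 0)
    (_hP : IsAnnihilatedOnTranscendentalBy S t P₉) (_hgen : TranscendentalEndomorphismsGeneratedBy S t)
    (σ : Module.End ℂ (K3Index → ℂ)) (_hσ : ∀ a b, k3Form (σ a) (σ b) = k3Form a b)
    (_hσrat : ∀ v : K3Index → ℤ, ∃ w : K3Index → ℚ, σ (fun i => (v i : ℂ)) = fun i => (w i : ℂ))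
    (_hconj : ∀ c : complexBetti S (2 * 1),
      (∀ d ∈ algebraicClasses S 1, cupProduct (rfl : 2 * 1 + 2 * 1 = 2 * 2) c d = 0) →
        σ (η (t c)) = thetaC θ (σ (η c))),
    HodgeConjectureFor 4 (S ⊗ S))

variable {g : Module.End ℂ (K3Index → ℂ)} {y₀ : K3Index → ℂ} {θ : Matrix K3Index K3Index ℚ}

/-! ### The model identity and the cubic -/

/-- **`θ_ℂ · (X³ - 3X + 1)(θ_ℂ) = 0` on `Λ_ℂ`** for a ζ₉ datum — the model hypothesis of
`hodgeConjectureFor_square_of_openAll_of_transc_of_separable`, from the quartic identity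
`thetaC_mul_cubic_eq_zero_of_zeta9Model`. [cite: GeemenSchutt2023, §2.4 and §5.6] -/
theorem aeval_X_mul_cubic_eq_zero_of_zeta9Model (hZ : Zeta9Model[g, y₀, θ]) :
    aeval (thetaC θ) (X * (P₉).map (algebraMap ℚ ℂ)) = 0 := by
  rw [map_mul, aeval_X, aeval_cubic_map_eq]
  exact thetaC_mul_cubic_eq_zero_of_zeta9Model hZ

/-- `X³ - 3X + 1` is separable (irreducible over the perfect field `ℚ`). [folklore] -/
theorem cubic_separable : (P₉).Separable := cubic_irreducible.separable

/-- `(X³ - 3X + 1)(0) = 1 ≠ 0`. [folklore] -/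
theorem cubic_eval_zero_ne_zero : (P₉).eval 0 ≠ 0 := by
  simp

/-! ### (T⁗) for a ζ₉ datum -/

/-- **(T⁗) for a ζ₉ datum, GIVEN the strong open input.** Let `(g, y₀, θ)` be a ζ₉ datum and suppose
`θ` is cycle-induced at EVERY period of an open `U ⊂ Λ_ℂ` meeting the Hodge locus `D_{θ,e₀}`,
`e₀ = 2cos(2π/9)`, in a `θ`-generic point (`OpenAll[θ, e₀]`). Then every marked projective K3 surface
`(S, η, p, x)` with an endomorphism `t` (rational, type-preserving, killing `N¹`, `t³ - 3t + 1 = 0` on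
`T(S)`, generating `End_Hdg T(S)`) conjugate to `θ_ℂ` ON `T(S)` by a rational isometry `σ` of `Λ_ℚ`
satisfies `HodgeConjectureFor 4 (S ⊗ S)` — `θ` is self-adjoint (`selfAdjoint_of_zeta9Model`), `e₀ ≠ 0`,
`θ(θ³ - 3θ + 1) = 0` (`aeval_X_mul_cubic_eq_zero_of_zeta9Model`), and
`hodgeConjectureFor_square_of_openAll_of_transc_of_separable` concludes. Unlike (T‴)
(`hodgeConjectureFor_square_of_zeta9Model_of_open`) the surface need NOT be `θ`-generic: its
transcendental lattice may be a proper `θ`-stable sublattice of the model's (`ρ(S) = 13`). CONDITIONAL on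
`Buskin2019_hodgeIsometry_algebraic` and the displayed input only; credits nothing.
[cite: GeemenSchutt2023, §2.1, §3.4, §4.8, §5.6 and §6.6] [cite: Buskin2019, Thm. 1.1]
[cite: Huybrechts2016K3, Ch. 6 Prop. 1.5 and Ch. 14 §0.3 (vi)] -/
theorem hodgeConjectureFor_square_of_zeta9Model_of_openAll
    (hB : Buskin2019_hodgeIsometry_algebraic) (hZ : Zeta9Model[g, y₀, θ])
    (hOpen : OpenAll[θ, (2 * Real.cos (2 * Real.pi / 9) : ℝ)]) : SubSquareHC[θ] := by
  intro S hS η p x hM t ht_rat ht_typ ht_N hP hgen σ hσ hσrat hconj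
  have hθP := aeval_X_mul_cubic_eq_zero_of_zeta9Model hZ
  obtain ⟨hg, -, hg9, -, -, -, -, hθ⟩ := hZ
  have hθsa : ∀ a b : K3Index → ℂ, k3Form (thetaC θ a) b = k3Form a (thetaC θ b) :=
    selfAdjoint_of_zeta9Model hg hg9 hθ
  have he₀ : (2 * Real.cos (2 * Real.pi / 9)) ≠ 0 := two_mul_cos_two_pi_div_nine_pos.ne'
  exact hodgeConjectureFor_square_of_openAll_of_transc_of_separable hB hθsa he₀ cubic_separable
    cubic_eval_zero_ne_zero hθP hOpen hS η p x hM t ht_rat ht_typ ht_N hP hgen σ hσ hσrat hconj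

end Summit.HodgeConjecture.HodgeConjecture.Theorems.MarkmanPartnerTransport.RMTypeOrbit

end
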